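import Summits.NavierStokesRegularity.NavierStokesRegularity.Theorems.FilamentSkeletonRssBoxSelectionRJ

/-!
# Route `FilamentSkeletonRss` · glue `Selection1A` (stmt-NavierStokesRegularity-27415; R-T/R-μ retype, Variant A1α):
# `SkeletonJ1 → TransverseReduction1A → RssProfileExists`

PORT (proof body verbatim) of `RetypeKit.selection1A_proof` from ns-idea-12 g2's certified retype kit
`Cruxes/SelectionBoxRJ/Lines/retype_R_T_kit.lean` (rev 2, sha16 266bbf1cb36828d9, commit c78ea7f5751d; kit text `retype_R-T_kit.md`
2733d311645080bc §10.3; director-ns dss_61 (1b) / dss_66 (1)(c)), landed by the filament lane `ns-filament-19175-p1` g10 against the route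
decls BY NAME after the tenure planner's route edit (ns-filament-repair-plan g7, rev 14–16: items 27413 `SkeletonJ1`, 27414
`TransverseReduction1A`, 27415 `Selection1A`; the decl texts in the Theses file are the kit's texts verbatim, so the kit proof re-threads
unchanged): ONE skeleton at `Γ = max Γ₁ Γ₂` ⇒ the unforced free-rate reduction gives an exact smooth decaying rotated-Leray profile with
some rate `α₁ ≠ 0` ⇒ `RssProfileExists` via the tree's `Theorems.stub_rssProfileExists_of_profile`.  No Poincaré–Miranda, no sign law, no
multipliers.  AUTHOR of the proof: ns-idea-12 g2 (planner-ns-idea-12-g2-0); this lineage landed the previous glues `boxSelectionR_proof` /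
`boxSelectionRJ_proof` (p555397) the same way.
HONEST FRAMING: glue between two OPEN cruxes of a MODEL route (negative side); nothing here bears on Navier–Stokes regularity or blow-up.
-/

set_option linter.dupNamespace false

noncomputable section

namespace Summit.NavierStokesRegularity.NavierStokesRegularity.Theorems

open Set Function Filter MeasureTheory Real
open Literature.Analysis.FluidPDE Literature.Analysis.FluidPDE.PineauVicol2026
open Summit.NavierStokesRegularity.NavierStokesRegularity.Theses.FilamentSkeletonRss
open scoped InnerProductSpace Laplacian ContDiff Topology BigOperators

/-- **Glue `Selection1A` (stmt-NavierStokesRegularity-27415), PROVED**: `SkeletonJ1 → TransverseReduction1A → RssProfileExists`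
(proof verbatim from ns-idea-12 g2's kit `RetypeKit.selection1A_proof`, retype_R_T_kit.lean 266bbf1cb36828d9). [folklore] -/
theorem selection1A_proof :
    Summit.NavierStokesRegularity.NavierStokesRegularity.Theses.FilamentSkeletonRss.Selection1A := by
  unfold Selection1A
  intro hbox hred
  classical
  obtain ⟨N, δ, ρ, K, Λ, a, b, cnd, η, Rw, Rb, cg, θ₀, Γ₂, hN, hδ, hρ, ha, _hcnd, hη, hRw, hRb, hcg, hθ₀, hbox⟩ :=
    hbox
  obtain ⟨Γ₁, hred⟩ := hred N δ ρ K Λ a b cnd η Rw Rb cg θ₀ hN hδ hρ ha hη hRw hRb hcg hθ₀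
  obtain ⟨γ, α, X, w, c, m, n, Aa, hfam⟩ := hbox (max Γ₁ Γ₂) (le_max_right _ _)
  set Γ : ℝ := max Γ₁ Γ₂
  set u : (Fin N → ℝ → EuclideanSpace ℝ (Fin 3)) → EuclideanSpace ℝ (Fin 3) → EuclideanSpace ℝ (Fin 3) :=
    fun Z y => ∑ k : Fin N, (Γ * γ k / (4 * π)) • ∫ σ : ℝ,
        ((‖y - Z k σ‖ ^ 2 + Real.exp (-(1 + Real.eulerMascheroniConstant - Real.log 2)) * Aa k σ) ^ (3 / 2 : ℝ))⁻¹ •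
          cross (deriv (Z k) σ) (y - Z k σ)
  set v : EuclideanSpace ℝ (Fin 3) → EuclideanSpace ℝ (Fin 3) :=
    fun y => u X y + (1 / 2 : ℝ) • y - α • cross (EuclideanSpace.single (2 : Fin 3) (1 : ℝ)) y
  set A : Fin N → (EuclideanSpace ℝ (Fin 3) →L[ℝ] EuclideanSpace ℝ (Fin 3)) := fun j => fderiv ℝ v (X j (c j))
  set T : (Fin N → ℝ → EuclideanSpace ℝ (Fin 3)) → Fin N → ℝ → EuclideanSpace ℝ (Fin 3) :=
    fun Z j τ => (u Z (Z j τ) + (1 / 2 : ℝ) • Z j τ - α • cross (EuclideanSpace.single (2 : Fin 3) (1 : ℝ)) (Z j τ)) -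
      (inner ℝ (u Z (Z j τ) + (1 / 2 : ℝ) • Z j τ - α • cross (EuclideanSpace.single (2 : Fin 3) (1 : ℝ)) (Z j τ)) (deriv (Z j) τ) /
        ‖deriv (Z j) τ‖ ^ 2) • deriv (Z j) τ
  have hskel := hfam u v A T (fun _ _ => rfl) (fun _ => rfl) (fun _ => rfl) (fun _ _ _ => rfl)
  obtain ⟨α₁, C₀, M, U, P, hα₁, hU0, hUs, hPs, hdiv, heq, hdec, hPM, -⟩ := hred Γ (le_max_left _ _) γ α X w c m n Aa u v A T
    (fun _ _ => rfl) (fun _ => rfl) (fun _ => rfl) (fun _ _ _ => rfl) hskel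
  have heq0 : ∀ y : EuclideanSpace ℝ (Fin 3), α₁ • (rotGen (U y) - fderiv ℝ U y (rotGen y)) +
      (1 / 2 : ℝ) • U y + (1 / 2 : ℝ) • fderiv ℝ U y y - (Δ U) y + fderiv ℝ U y (U y) + gradient P y = 0 := by
    intro y
    simp only [splitGlue_rotGen_eq_cross_single_two]
    exact heq y
  exact stub_rssProfileExists_of_profile ⟨α₁, C₀, M, U, P, hα₁, hU0, hUs, hPs, hdiv, heq0, hdec, hPM⟩

end Summit.NavierStokesRegularity.NavierStokesRegularity.Theorems
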